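import Summits.RiemannHypothesis.RiemannHypothesis.Theorems.AsymptoticCriticalLine.Negative.KnownEnd
import Literature.NumberTheory.LFunctions.ZetaArgVariation
import Literature.NumberTheory.LFunctions.ZeroCountingProofs
import Literature.NumberTheory.LFunctions.SelbergZeroDensityNearHalf

/-!
# "Almost all" is a theorem, "all but finitely many" is the crux (negative-side locator for `AsymptoticCriticalLine`)

Refuter work file (cdisprove, cycle 4) supporting crux stmt-RiemannHypothesis-2063
(`RuelleBand.AsymptoticCriticalLine`: for every `ε > 0` only FINITELY MANY zeros of `ζ` in the
open strip have `|Re s − 1/2| ≥ ε`).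

The DENSITY-ONE version of the crux is an unconditional theorem of the tree: by Ingham's
zero-density estimate (`zeroDensity_ingham_holds`, PROVED; packaged at level `ε` as
`countRe_isBigO_of_ingham`: `N(1/2 + ε, T) = O(T^{1 − 2ε/(3 − 2ε)})`) and the Riemann–von Mangoldt
formula (`riemann_von_mangoldt_holds`, PROVED; `T ≤ N(T)` eventually), the PROPORTION of the zeros
up to height `T` lying in the band of level `ε` is `O(T^{−2ε/(3−2ε)}) → 0`
(`bandProportion_isBigO_rpow_neg`, `tendsto_bandProportion_zero`): almost all zeros lie within
`ε` of the critical line, for every `ε > 0` (Bohr–Landau 1914 in density form; Selberg 1946 even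
with the shrinking level `ε(T) = A log log T / log T`, PROVED here from the tree's uniform Selberg
density theorem: `tendsto_shrinkingBandProportion_zero`). The crux is the EVERYWHERE version of this almost-everywhere theorem — the
count itself bounded (`countRe_bounded_of_acl`), not its proportion vanishing — and between
"proportion `O(T^{−δ})`" and "count `O(1)`" nothing is known for `ζ` (barrier
`LindelofBacklund`: even the Lindelöf hypothesis gives only `o(log T)` new band zeros per unit
window). No kill follows: the statements are compatible; this file only locates the crux.

All statements `sorry`-free; axioms `propext`, `Classical.choice`, `Quot.sound`.
-/

noncomputable section

set_option linter.dupNamespace false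

namespace Summit.RiemannHypothesis.RiemannHypothesis.Theorems.AsymptoticCriticalLine.Negative

open Filter Asymptotics
open Literature.NumberTheory.LFunctions (zetaZeroCountRe zetaZeroCount riemann_von_mangoldt_holds
  zetaZeroCountRe_anti_left_holds)

/-- The proportion of the zeros `0 < Im ρ ≤ T` (with multiplicity) lying in the right half-band
`Re ρ ≥ 1/2 + ε`. [folklore] -/
def bandProportion (ε T : ℝ) : ℝ :=
  (zetaZeroCountRe (1 / 2 + ε) T : ℝ) / zetaZeroCount T

/-- The proportion is at most `1` (`N(σ, T)` is antitone in `σ`). [folklore] -/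
theorem bandProportion_le_one {ε : ℝ} (hε : 0 ≤ ε) (T : ℝ) : bandProportion ε T ≤ 1 := by
  unfold bandProportion
  have h : zetaZeroCountRe (1 / 2 + ε) T ≤ zetaZeroCount T :=
    zetaZeroCountRe_anti_left_holds T (by linarith : (0 : ℝ) ≤ 1 / 2 + ε)
  rcases Nat.eq_zero_or_pos (zetaZeroCount T) with h0 | hpos
  · rw [h0, Nat.cast_zero, div_zero]
    exact zero_le_one
  · rw [div_le_one (by exact_mod_cast hpos)]
    exact_mod_cast h

/-- [folklore] -/
theorem bandProportion_nonneg (ε T : ℝ) : 0 ≤ bandProportion ε T := by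
  unfold bandProportion
  positivity

/-- ALMOST ALL ZEROS LIE IN EVERY BAND (Ingham + Riemann–von Mangoldt, both PROVED in tree): the
proportion of zeros up to height `T` with `Re ρ ≥ 1/2 + ε` is `O(T^{−2ε/(3−2ε)})`. [folklore] -/
theorem bandProportion_isBigO_rpow_neg {ε : ℝ} (hε : 0 < ε) (hε' : ε ≤ 1 / 2) :
    (bandProportion ε) =O[atTop] fun T : ℝ => T ^ (-(2 * ε / (3 - 2 * ε))) := by
  obtain ⟨C, hC, hbd⟩ := (countRe_isBigO_of_ingham hε hε').exists_pos
  refine IsBigO.of_bound C ?_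
  filter_upwards [hbd.bound, riemann_von_mangoldt_holds.eventually_self_le,
    eventually_ge_atTop (1 : ℝ)] with T hb hN h1
  have hT : 0 < T := by linarith
  have hNpos : (0 : ℝ) < zetaZeroCount T := by linarith
  rw [Real.norm_of_nonneg (bandProportion_nonneg ε T),
    Real.norm_of_nonneg (Real.rpow_nonneg hT.le _)]
  rw [Real.norm_natCast, Real.norm_of_nonneg (Real.rpow_nonneg hT.le _)] at hb
  unfold bandProportion
  rw [div_le_iff₀ hNpos]
  have hpow : T ^ (1 - 2 * ε / (3 - 2 * ε)) = T ^ (-(2 * ε / (3 - 2 * ε))) * T := by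
    rw [show (1 : ℝ) - 2 * ε / (3 - 2 * ε) = -(2 * ε / (3 - 2 * ε)) + 1 by ring,
      Real.rpow_add hT, Real.rpow_one]
  calc (zetaZeroCountRe (1 / 2 + ε) T : ℝ) ≤ C * T ^ (1 - 2 * ε / (3 - 2 * ε)) := hb
    _ = C * T ^ (-(2 * ε / (3 - 2 * ε))) * T := by rw [hpow, mul_assoc]
    _ ≤ C * T ^ (-(2 * ε / (3 - 2 * ε))) * zetaZeroCount T :=
        mul_le_mul_of_nonneg_left hN (by positivity)

/-- … hence tends to `0`: for every `ε > 0`, asymptotically 100% of the zeros satisfy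
`Re ρ < 1/2 + ε` (and symmetrically `Re ρ > 1/2 − ε`). The crux asks that the EXCEPTIONS be
finitely many, not merely of density zero. [folklore] -/
theorem tendsto_bandProportion_zero {ε : ℝ} (hε : 0 < ε) :
    Tendsto (bandProportion ε) atTop (nhds 0) := by
  by_cases hε' : ε ≤ 1 / 2
  · have hδ : 0 < 2 * ε / (3 - 2 * ε) := by
      have : 0 < 3 - 2 * ε := by linarith
      positivity
    have h0 : Tendsto (fun T : ℝ => T ^ (-(2 * ε / (3 - 2 * ε)))) atTop (nhds 0) :=
      tendsto_rpow_neg_atTop hδ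
    exact (bandProportion_isBigO_rpow_neg hε hε').trans_tendsto h0
  · -- for `ε > 1/2` the band is empty: `N(1/2 + ε, T) = 0` (no zeros with `Re ρ > 1`)
    have hzero : ∀ T, bandProportion ε T = 0 := by
      intro T
      unfold bandProportion
      have : zetaZeroCountRe (1 / 2 + ε) T = 0 := by
        unfold zetaZeroCountRe
        have hemp : Literature.NumberTheory.LFunctions.zetaZeroBox (1 / 2 + ε) T = ∅ := by
          ext ρ
          simp only [Literature.NumberTheory.LFunctions.zetaZeroBox, Set.mem_setOf_eq,
            Set.mem_empty_iff_false, iff_false, not_and]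
          intro _ hσ h1 _ _
          linarith
        rw [hemp, finsum_mem_empty]
        rfl
      rw [this, Nat.cast_zero, zero_div]
    rw [show bandProportion ε = fun _ => 0 from funext hzero]
    exact tendsto_const_nhds

/-! ## Selberg strength: the proved band may even shrink like `log log T / log T` -/

/-- `T^{1 − κη} · log T = T / log T` for `η = (2/κ) log log T / log T` (`T > 1`, `log T > 0`).
[folklore] -/
theorem rpow_shrink_eq {κ T : ℝ} (hκ : κ ≠ 0) (hT : 1 < T) (hlog : 0 < Real.log T) :
    T ^ (1 - κ * (2 / κ * Real.log (Real.log T) / Real.log T)) * Real.log T = T / Real.log T := by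
  have hT0 : 0 < T := by linarith
  have h1 : κ * (2 / κ * Real.log (Real.log T) / Real.log T) = 2 * Real.log (Real.log T) / Real.log T := by
    field_simp
  rw [h1, Real.rpow_def_of_pos hT0]
  have h2 : Real.log T * (1 - 2 * Real.log (Real.log T) / Real.log T) =
      Real.log T - 2 * Real.log (Real.log T) := by
    field_simp
  rw [h2, Real.exp_sub, Real.exp_log hT0, show (2 : ℝ) * Real.log (Real.log T) =
    Real.log (Real.log T) + Real.log (Real.log T) by ring, Real.exp_add, Real.exp_log hlog]
  field_simp

/-- ALMOST ALL ZEROS AT SELBERG'S SCALE (Selberg 1946 Thm 1, PROVED in tree as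
`SelbergDensity.selberg_zeroDensity_near_half`: `N(σ, T) ≤ C T^{1 − κ(σ−1/2)} log T` uniformly in
`1/2 ≤ σ ≤ 1`): with the SHRINKING level `ε(T) = A log log T / log T` (`A = 2/κ`) the proportion of
zeros up to height `T` with `Re ρ ≥ 1/2 + ε(T)` is `≤ C / log T` eventually, hence `→ 0`. So almost
all zeros satisfy `|Re ρ − 1/2| < A log log T / log T`, unconditionally; the crux asks for the
fixed-`ε` band to be FINITE. [cite: Titchmarsh1986, Thm. 9.19 (C)] -/
theorem tendsto_shrinkingBandProportion_zero :
    ∃ A : ℝ, 0 < A ∧ Tendsto (fun T : ℝ =>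
      (zetaZeroCountRe (1 / 2 + A * Real.log (Real.log T) / Real.log T) T : ℝ) / zetaZeroCount T)
      atTop (nhds 0) := by
  obtain ⟨κ, hκ, C, T₀, hD⟩ := Literature.NumberTheory.LFunctions.SelbergDensity.selberg_zeroDensity_near_half
  refine ⟨2 / κ, by positivity, ?_⟩
  -- `log log T / log T → 0`, so the level is eventually in `[0, 1/2]`
  have hsmall : Tendsto (fun T : ℝ => Real.log (Real.log T) / Real.log T) atTop (nhds 0) := by
    have h := Real.isLittleO_log_id_atTop.comp_tendsto Real.tendsto_log_atTop
    simpa using h.tendsto_div_nhds_zero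
  have hlev : ∀ᶠ T : ℝ in atTop, 0 ≤ 2 / κ * Real.log (Real.log T) / Real.log T ∧
      2 / κ * Real.log (Real.log T) / Real.log T ≤ 1 / 2 := by
    have h1 : ∀ᶠ T : ℝ in atTop, Real.log (Real.log T) / Real.log T ≤ κ / 4 :=
      (hsmall.eventually (ge_mem_nhds (by positivity : (0 : ℝ) < κ / 4)))
    have h2 : ∀ᶠ T : ℝ in atTop, Real.exp 1 ≤ T := eventually_ge_atTop _
    filter_upwards [h1, h2] with T h1 h2
    have hT1 : 1 < T := lt_of_lt_of_le (by have := Real.add_one_le_exp (1 : ℝ); linarith) h2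
    have hlogT : 1 ≤ Real.log T := by
      rw [← Real.log_exp 1]
      exact Real.log_le_log (Real.exp_pos 1) h2
    have hll : 0 ≤ Real.log (Real.log T) := Real.log_nonneg hlogT
    constructor
    · positivity
    · rw [mul_div_assoc]
      calc 2 / κ * (Real.log (Real.log T) / Real.log T) ≤ 2 / κ * (κ / 4) :=
            mul_le_mul_of_nonneg_left h1 (by positivity)
        _ = 1 / 2 := by field_simp; ring
  -- the bound `≤ C / log T`, which tends to `0`
  have hbound : ∀ᶠ T : ℝ in atTop,
      (zetaZeroCountRe (1 / 2 + 2 / κ * Real.log (Real.log T) / Real.log T) T : ℝ) / zetaZeroCount T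
        ≤ |C| / Real.log T := by
    filter_upwards [hlev, eventually_ge_atTop T₀, eventually_ge_atTop (Real.exp 1),
      riemann_von_mangoldt_holds.eventually_self_le] with T hlev hT₀ hTe hN
    have hT1 : 1 < T := lt_of_lt_of_le (by have := Real.add_one_le_exp (1 : ℝ); linarith) hTe
    have hT0 : 0 < T := by linarith
    have hlog : 0 < Real.log T := Real.log_pos hT1
    have hNpos : (0 : ℝ) < zetaZeroCount T := by linarith
    have h := hD T hT₀ (1 / 2 + 2 / κ * Real.log (Real.log T) / Real.log T) (by linarith [hlev.1])
      (by linarith [hlev.2])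
    rw [show 1 / 2 + 2 / κ * Real.log (Real.log T) / Real.log T - 1 / 2 =
      2 / κ * Real.log (Real.log T) / Real.log T by ring] at h
    rw [mul_assoc, rpow_shrink_eq hκ.ne' hT1 hlog] at h
    rw [div_le_iff₀ hNpos]
    calc (zetaZeroCountRe (1 / 2 + 2 / κ * Real.log (Real.log T) / Real.log T) T : ℝ)
        ≤ C * (T / Real.log T) := h
      _ ≤ |C| * (T / Real.log T) := mul_le_mul_of_nonneg_right (le_abs_self C) (by positivity)
      _ = |C| / Real.log T * T := by field_simp
      _ ≤ |C| / Real.log T * zetaZeroCount T := mul_le_mul_of_nonneg_left hN (by positivity)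
  have hlim : Tendsto (fun T : ℝ => |C| / Real.log T) atTop (nhds 0) :=
    tendsto_const_nhds.div_atTop Real.tendsto_log_atTop
  refine tendsto_of_tendsto_of_tendsto_of_le_of_le' tendsto_const_nhds hlim ?_ hbound
  filter_upwards with T
  positivity

end Summit.RiemannHypothesis.RiemannHypothesis.Theorems.AsymptoticCriticalLine.Negative
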